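import Summits.MatrixMultiplication.MatrixMultiplication.Theorems.SubgroupIdentityDesigns.Negative.TripleCells

/-!
# Shifted triple rectangles and the `{1,3}` placement (negative lemmas for the crux
# `SubgroupIdentityDesigns`, stmt-MatrixMultiplication-14079) — VALUE = THEOREM (all p, explicit
# certificate), NOT summit progress; the crux stays open.

Two extensions of the triple rectangle law of `TripleCells`.

* SHIFT.  A design `f` for `(H₁, H₂, H₃)` and a point `h₀ = a₀ c₀` (`a₀ ∈ H₁`, `c₀ ∈ H₃`) give the
  shifted design `g ↦ f (a₀⁻¹ g c₀⁻¹)`: level 1, equal to `1` at `h₀`, vanishing on every other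
  triple product.  Hence a rectangle `{ε, ε'} × {δ, δ'}` whose four upper cells are triple
  products and ONE of whose cells contains a point of `H₁H₃` excludes a level-1 identity design
  (`no_idTest_of_cells_in_triple_shift`; the certificate takes the values `±1` on its cells,
  `exists_urect_annihilator_val`).  The rectangle need not pass through the identity.
* PLACEMENT `{1,3}`.  If `U⁺ ≤ H₁` and `U⁻ ≤ H₃` (the two `p`-members in the outer positions), an
  element `s` of the MIDDLE member with `s₁₁ ≠ 0` is upper-triangularised from the right:
  `U⁺ · t₁ · s · t₃ · [[1,0],[-(s t₃)₁₀/(s t₃)₁₁, 1]] = B(ε₁ε₃ det s/s₁₁, δ₁δ₃ s₁₁)`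
  (`cell_of_triple₁₃`), whence `no_idTest_triple_frame₁₃` and the full-torus corollary
  `no_levelOne_design_fullTorus₁₃`: if `H₁ ⊇ U⁺ · {diag(1, δ)}` and `U⁻ ≤ H₃`, every `s ∈ H₂` with
  `s₁₁ ≠ 0` has `det s = s₁₁`.  (The placement `{2,3}` reduces to `{1,2}` by
  `Reversal.design_reverse`.)
-/

set_option linter.dupNamespace false

noncomputable section

open scoped BigOperators Classical
open Summit.MatrixMultiplication.MatrixMultiplication.Theorems.LieRankDesigns.Negative
  (GLm Mat fourierFn)
open Summit.MatrixMultiplication.MatrixMultiplication.Theorems.LevelOneGL2Designs.Negative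
  (levelSubmodule mem_levelSubmodule_iff fourierFn_mem_levelSubmodule levelSubmodule_bi_inv)

namespace Summit.MatrixMultiplication.MatrixMultiplication.Theorems.SubgroupIdentityDesigns.Negative

section TripleShift

variable {p : ℕ} [hp : Fact p.Prime]

/-- The rectangle certificate with its VALUES: non-zero (`±1`) at every point of its four cells. -/
theorem exists_urect_annihilator_val {ε ε' δ δ' : ZMod p} (hε : ε ≠ 0) (hε' : ε' ≠ 0)
    (hδ : δ ≠ 0) (hδ' : δ' ≠ 0) (hεε' : ε ≠ ε') (hδδ' : δ ≠ δ') :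
    ∃ lam : GLm p 2 → ℂ,
      (∀ (g : GLm p 2) (α β x : ZMod p), (α = ε ∨ α = ε') → (β = δ ∨ β = δ') →
        (g : Mat p 2) = !![α, x; 0, β] → lam g ≠ 0) ∧
      (∀ g, lam g ≠ 0 → ∃ α β x : ZMod p, (α = ε ∨ α = ε') ∧ (β = δ ∨ β = δ') ∧
        (g : Mat p 2) = !![α, x; 0, β]) ∧
      ∀ F ∈ levelSubmodule p 2 1, ∑ g, lam g * F g = 0 := by
  -- the explicit certificate of `exists_urect_annihilator`, rebuilt to read off its values
  refine ⟨fun g =>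
      (∑ x : ZMod p, if (g : Mat p 2) = !![ε, x; 0, δ] then (1 : ℂ) else 0)
      - (∑ x : ZMod p, if (g : Mat p 2) = !![ε', x; 0, δ] then (1 : ℂ) else 0)
      - (∑ x : ZMod p, if (g : Mat p 2) = !![ε, x; 0, δ'] then (1 : ℂ) else 0)
      + (∑ x : ZMod p, if (g : Mat p 2) = !![ε', x; 0, δ'] then (1 : ℂ) else 0), ?_, ?_, ?_⟩
  · intro g α β x hα hβ hg
    simp only [hg, ucell_eq_iff]
    rcases hα with rfl | rfl <;> rcases hβ with rfl | rfl <;>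
      simp [hεε', hδδ', hεε'.symm, hδδ'.symm, Finset.sum_ite_eq]
  · intro g hg
    by_contra hne
    apply hg
    have h0 : ∀ α β : ZMod p, (α = ε ∨ α = ε') → (β = δ ∨ β = δ') →
        (∑ x : ZMod p, if (g : Mat p 2) = !![α, x; 0, β] then (1 : ℂ) else 0) = 0 := by
      intro α β hα hβ
      exact Finset.sum_eq_zero fun x _ => if_neg fun h => hne ⟨α, β, x, hα, hβ, h⟩
    simp only [h0 ε δ (Or.inl rfl) (Or.inl rfl), h0 ε' δ (Or.inr rfl) (Or.inl rfl),
      h0 ε δ' (Or.inl rfl) (Or.inr rfl), h0 ε' δ' (Or.inr rfl) (Or.inr rfl), sub_zero, add_zero]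
  · intro F hF
    obtain ⟨c, hc, hFc⟩ := mem_levelSubmodule_iff.mp hF
    have hF' : F = fourierFn c := funext hFc
    subst hF'
    simp only [sub_mul, add_mul, Finset.sum_sub_distrib, Finset.sum_add_distrib]
    rw [ucell_push ε δ (mul_ne_zero hε hδ) c, ucell_push ε' δ (mul_ne_zero hε' hδ) c,
      ucell_push ε δ' (mul_ne_zero hε hδ') c, ucell_push ε' δ' (mul_ne_zero hε' hδ') c,
      ← Finset.sum_sub_distrib, ← Finset.sum_sub_distrib, ← Finset.sum_add_distrib]
    refine Finset.sum_eq_zero fun M _ => ?_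
    rw [← mul_sub, ← mul_sub, ← mul_add]
    by_cases hM : M.det = 0
    · rw [ucell_bracket M hM, mul_zero]
    · rw [hc M (one_lt_rank_of_det_ne_zero M hM), zero_mul]

/-- The shifted design: a level-1 identity test for `(H₁, H₂, H₃)` and `a₀ ∈ H₁`, `c₀ ∈ H₃` give a
level-1 function equal to `1` at `a₀ c₀` and `0` at every other triple product. -/
theorem shifted_design {H₁ H₂ H₃ : Subgroup (GLm p 2)}
    (hdes : ∃ f ∈ levelSubmodule p 2 1, f 1 = 1 ∧
      ∀ a ∈ H₁, ∀ b ∈ H₂, ∀ c ∈ H₃, a * b * c ≠ 1 → f (a * b * c) = 0)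
    {a₀ c₀ : GLm p 2} (ha₀ : a₀ ∈ H₁) (hc₀ : c₀ ∈ H₃) :
    ∃ f ∈ levelSubmodule p 2 1, f (a₀ * c₀) = 1 ∧
      ∀ a ∈ H₁, ∀ b ∈ H₂, ∀ c ∈ H₃, a * b * c ≠ a₀ * c₀ → f (a * b * c) = 0 := by
  obtain ⟨f, hf, hf1, hf0⟩ := hdes
  refine ⟨fun g => f (a₀⁻¹ * g * c₀⁻¹), levelSubmodule_bi_inv f hf a₀⁻¹ c₀⁻¹, ?_, ?_⟩
  · simp only
    rw [show a₀⁻¹ * (a₀ * c₀) * c₀⁻¹ = 1 by group, hf1]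
  · intro a ha b hb c hc hne
    simp only
    rw [show a₀⁻¹ * (a * b * c) * c₀⁻¹ = a₀⁻¹ * a * b * (c * c₀⁻¹) by group]
    refine hf0 _ (H₁.mul_mem (H₁.inv_mem ha₀) ha) b hb _ (H₃.mul_mem hc (H₃.inv_mem hc₀)) ?_
    intro h
    apply hne
    rw [show a * b * c = a₀ * (a₀⁻¹ * a * b * (c * c₀⁻¹)) * c₀ by group, h, mul_one]

/-- **SHIFTED TRIPLE RECTANGLE LAW (no TPP needed).**  If the four upper cells over a rectangle
`{ε, ε'} × {δ, δ'}` consist of triple products and one cell contains a point `a₀ c₀` of `H₁H₃`,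
there is no level-1 identity test. -/
theorem no_idTest_of_cells_in_triple_shift {H₁ H₂ H₃ : Subgroup (GLm p 2)}
    {ε ε' δ δ' : ZMod p} (hε : ε ≠ 0) (hε' : ε' ≠ 0) (hδ : δ ≠ 0) (hδ' : δ' ≠ 0)
    (hεε' : ε ≠ ε') (hδδ' : δ ≠ δ')
    (hcell : ∀ α β : ZMod p, (α = ε ∨ α = ε') → (β = δ ∨ β = δ') → ∀ x : ZMod p,
      ∃ a ∈ H₁, ∃ b ∈ H₂, ∃ c ∈ H₃, ((a * b * c : GLm p 2) : Mat p 2) = !![α, x; 0, β])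
    {a₀ c₀ : GLm p 2} (ha₀ : a₀ ∈ H₁) (hc₀ : c₀ ∈ H₃) {α₀ β₀ x₀ : ZMod p}
    (hα₀ : α₀ = ε ∨ α₀ = ε') (hβ₀ : β₀ = δ ∨ β₀ = δ')
    (h₀ : ((a₀ * c₀ : GLm p 2) : Mat p 2) = !![α₀, x₀; 0, β₀]) :
    ¬ ∃ f ∈ levelSubmodule p 2 1, f 1 = 1 ∧
        ∀ a ∈ H₁, ∀ b ∈ H₂, ∀ c ∈ H₃, a * b * c ≠ 1 → f (a * b * c) = 0 := by
  intro hdes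
  obtain ⟨f, hf, hf1, hf0⟩ := shifted_design hdes ha₀ hc₀
  obtain ⟨lam, hval, hsupp, hann⟩ := exists_urect_annihilator_val hε hε' hδ hδ' hεε' hδδ'
  have hzero : ∀ g : GLm p 2, g ≠ a₀ * c₀ → lam g * f g = 0 := by
    intro g hg
    by_cases hl : lam g = 0
    · rw [hl, zero_mul]
    · obtain ⟨α, β, x, hα, hβ, hgx⟩ := hsupp g hl
      obtain ⟨a, ha, b, hb, c, hc, habc⟩ := hcell α β hα hβ x
      have hg' : g = a * b * c := Units.ext (hgx.trans habc.symm)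
      rw [hg', hf0 a ha b hb c hc (hg' ▸ hg), mul_zero]
  have h := hann f hf
  rw [Finset.sum_eq_single (a₀ * c₀) (fun g _ hg => hzero g hg)
    (fun h' => absurd (Finset.mem_univ _) h'), hf1, mul_one] at h
  exact hval _ α₀ β₀ x₀ hα₀ hβ₀ h₀ h

/-- Cells for the placement `{1,3}`: `U⁺ ≤ H₁`, `U⁻ ≤ H₃`, diagonal `t₁ ∈ H₁`, `t₃ ∈ H₃`, and
`s ∈ H₂` (the middle member) with `s₁₁ ≠ 0` give the whole cell
`B(ε₁ε₃·det s/s₁₁, δ₁δ₃·s₁₁)` as triple products. -/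
theorem cell_of_triple₁₃ {H₁ H₂ H₃ : Subgroup (GLm p 2)}
    (hU : ∀ u : GLm p 2, (u : Mat p 2) 1 0 = 0 → (u : Mat p 2) 0 0 = 1 → (u : Mat p 2) 1 1 = 1 →
      u ∈ H₁)
    (hV : ∀ v : GLm p 2, (v : Mat p 2) 0 1 = 0 → (v : Mat p 2) 0 0 = 1 → (v : Mat p 2) 1 1 = 1 →
      v ∈ H₃)
    {ε₁ δ₁ ε₃ δ₃ : ZMod p} {t₁ t₃ : GLm p 2} (ht₁ : t₁ ∈ H₁)
    (ht₁d : (t₁ : Mat p 2) = !![ε₁, 0; 0, δ₁]) (ht₃ : t₃ ∈ H₃)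
    (ht₃d : (t₃ : Mat p 2) = !![ε₃, 0; 0, δ₃])
    {s : GLm p 2} (hs : s ∈ H₂) (hs1 : (s : Mat p 2) 1 1 ≠ 0) (x : ZMod p) :
    ∃ a ∈ H₁, ∃ b ∈ H₂, ∃ c ∈ H₃, ((a * b * c : GLm p 2) : Mat p 2) =
      !![ε₁ * ε₃ * Matrix.det (s : Mat p 2) / (s : Mat p 2) 1 1, x;
        0, δ₁ * δ₃ * (s : Mat p 2) 1 1] := by
  have hds : Matrix.det (s : Mat p 2) ≠ 0 := Matrix.GeneralLinearGroup.det_ne_zero s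
  have hdt₁ : Matrix.det (t₁ : Mat p 2) ≠ 0 := Matrix.GeneralLinearGroup.det_ne_zero t₁
  have hdt₃ : Matrix.det (t₃ : Mat p 2) ≠ 0 := Matrix.GeneralLinearGroup.det_ne_zero t₃
  rw [ht₁d, Matrix.det_fin_two_of, mul_zero, sub_zero] at hdt₁
  rw [ht₃d, Matrix.det_fin_two_of, mul_zero, sub_zero] at hdt₃
  have hε₁ : ε₁ ≠ 0 := left_ne_zero_of_mul hdt₁
  have hδ₁ : δ₁ ≠ 0 := right_ne_zero_of_mul hdt₁
  have hε₃ : ε₃ ≠ 0 := left_ne_zero_of_mul hdt₃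
  have hδ₃ : δ₃ ≠ 0 := right_ne_zero_of_mul hdt₃
  set α : ZMod p := ε₁ * ε₃ * Matrix.det (s : Mat p 2) / (s : Mat p 2) 1 1 with hαdef
  set β : ZMod p := δ₁ * δ₃ * (s : Mat p 2) 1 1 with hβdef
  have hβ : β ≠ 0 := mul_ne_zero (mul_ne_zero hδ₁ hδ₃) hs1
  -- `s t₃` and its right upper-triangularisation
  have hst : ((s * t₃ : GLm p 2) : Mat p 2) =
      !![(s : Mat p 2) 0 0 * ε₃, (s : Mat p 2) 0 1 * δ₃;
        (s : Mat p 2) 1 0 * ε₃, (s : Mat p 2) 1 1 * δ₃] := by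
    rw [Units.val_mul, ht₃d]
    ext i j
    fin_cases i <;> fin_cases j <;> simp [Matrix.mul_apply, Fin.sum_univ_two]
  obtain ⟨v, hv⟩ : ∃ v : GLm p 2,
      (v : Mat p 2) = !![1, 0; -((s : Mat p 2) 1 0 * ε₃) / ((s : Mat p 2) 1 1 * δ₃), 1] :=
    ⟨Matrix.GeneralLinearGroup.mkOfDetNeZero _ (by rw [Matrix.det_fin_two_of]; simp), rfl⟩
  have hstv : ((s * t₃ * v : GLm p 2) : Mat p 2) =
      !![ε₃ * Matrix.det (s : Mat p 2) / (s : Mat p 2) 1 1, (s : Mat p 2) 0 1 * δ₃;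
        0, (s : Mat p 2) 1 1 * δ₃] := by
    rw [Units.val_mul, hst, hv, Matrix.mul_fin_two, Matrix.det_fin_two]
    ext i j
    fin_cases i <;> fin_cases j <;> simp <;> field_simp <;> ring
  have htstv : ((t₁ * (s * t₃ * v) : GLm p 2) : Mat p 2) =
      !![α, ε₁ * ((s : Mat p 2) 0 1 * δ₃); 0, β] := by
    rw [Units.val_mul, ht₁d, hstv, Matrix.mul_fin_two, hαdef, hβdef]
    ext i j
    fin_cases i <;> fin_cases j <;> simp <;> ring
  obtain ⟨u, hu⟩ : ∃ u : GLm p 2,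
      (u : Mat p 2) = !![1, (x - ε₁ * ((s : Mat p 2) 0 1 * δ₃)) / β; 0, 1] :=
    ⟨Matrix.GeneralLinearGroup.mkOfDetNeZero _ (by rw [Matrix.det_fin_two_of]; simp), rfl⟩
  refine ⟨u * t₁, H₁.mul_mem (hU u (by simp [hu]) (by simp [hu]) (by simp [hu])) ht₁, s, hs,
    t₃ * v, H₃.mul_mem ht₃ (hV v (by simp [hv]) (by simp [hv]) (by simp [hv])), ?_⟩
  have hassoc : u * t₁ * s * (t₃ * v) = u * (t₁ * (s * t₃ * v)) := by simp only [mul_assoc]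
  rw [hassoc, Units.val_mul, htstv, hu, Matrix.mul_fin_two]
  ext i j
  fin_cases i <;> fin_cases j <;> simp [div_mul_cancel₀ _ hβ]

/-- **TRIPLE RECTANGLE LAW, placement `{1,3}`.**  `U⁺ ≤ H₁ ∋ diag(1, μ), diag(1, 1/s₁₁),
diag(1, μ/s₁₁)`, `U⁻ ≤ H₃`, and `s ∈ H₂` with `s₁₁ ≠ 0`, `det s ≠ s₁₁` (`μ ∉ {0,1}`): no level-1
identity test — the cells over `{1, det s/s₁₁} × {1, μ}` are triple products. -/
theorem no_idTest_triple_frame₁₃ {H₁ H₂ H₃ : Subgroup (GLm p 2)}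
    (hU : ∀ u : GLm p 2, (u : Mat p 2) 1 0 = 0 → (u : Mat p 2) 0 0 = 1 → (u : Mat p 2) 1 1 = 1 →
      u ∈ H₁)
    (hV : ∀ v : GLm p 2, (v : Mat p 2) 0 1 = 0 → (v : Mat p 2) 0 0 = 1 → (v : Mat p 2) 1 1 = 1 →
      v ∈ H₃)
    {μ : ZMod p} (hμ0 : μ ≠ 0) (hμ1 : μ ≠ 1)
    {s : GLm p 2} (hs : s ∈ H₂) (hs1 : (s : Mat p 2) 1 1 ≠ 0)
    (hsd : Matrix.det (s : Mat p 2) ≠ (s : Mat p 2) 1 1)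
    {tμ t₁ t₂ : GLm p 2} (htμ : tμ ∈ H₁) (htμd : (tμ : Mat p 2) = !![1, 0; 0, μ])
    (ht₁ : t₁ ∈ H₁) (ht₁d : (t₁ : Mat p 2) = !![1, 0; 0, ((s : Mat p 2) 1 1)⁻¹])
    (ht₂ : t₂ ∈ H₁) (ht₂d : (t₂ : Mat p 2) = !![1, 0; 0, μ * ((s : Mat p 2) 1 1)⁻¹]) :
    ¬ ∃ f ∈ levelSubmodule p 2 1, f 1 = 1 ∧
        ∀ a ∈ H₁, ∀ b ∈ H₂, ∀ c ∈ H₃, a * b * c ≠ 1 → f (a * b * c) = 0 := by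
  have hds : Matrix.det (s : Mat p 2) ≠ 0 := Matrix.GeneralLinearGroup.det_ne_zero s
  have ha0 : Matrix.det (s : Mat p 2) / (s : Mat p 2) 1 1 ≠ 0 := div_ne_zero hds hs1
  have ha1 : Matrix.det (s : Mat p 2) / (s : Mat p 2) 1 1 ≠ 1 := fun h =>
    hsd (by rwa [div_eq_one_iff_eq hs1] at h)
  refine no_idTest_of_cells_in_triple ha0 ha1 hμ0 hμ1 fun α β hα hβ x => ?_
  rcases hα with hα | hα
  · -- column `α = 1`: cells inside `H₁ · 1 · 1`
    have hdiag : ∃ a' ∈ H₁, ∃ b ∈ (⊥ : Subgroup (GLm p 2)),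
        ((a' * b : GLm p 2) : Mat p 2) = !![1, 0; 0, β] := by
      rcases hβ with hβ | hβ
      · exact ⟨1, H₁.one_mem, 1, Subgroup.mem_bot.2 rfl, by rw [mul_one, coe_one_eq_ucell, hβ]⟩
      · exact ⟨tμ, htμ, 1, Subgroup.mem_bot.2 rfl, by rw [mul_one, htμd, hβ]⟩
    obtain ⟨a', ha', b, hb, hab⟩ := ucell_of_left hU
      (by rcases hβ with hβ | hβ <;> rw [hβ]; exacts [one_ne_zero, hμ0]) hdiag x
    rw [Subgroup.mem_bot] at hb
    subst hb
    exact ⟨a', ha', 1, H₂.one_mem, 1, H₃.one_mem, by rw [mul_one, hab, hα]⟩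
  · -- column `α = det s/s₁₁`: cells through `s`
    have h1d : ((1 : GLm p 2) : Mat p 2) = !![1, 0; 0, 1] := coe_one_eq_ucell
    rcases hβ with hβ | hβ
    · obtain ⟨a₁, ha₁, b₁, hb₁, c, hc, h⟩ := cell_of_triple₁₃ hU hV ht₁ ht₁d H₃.one_mem h1d hs hs1 x
      refine ⟨a₁, ha₁, b₁, hb₁, c, hc, ?_⟩
      rw [h, hα, hβ, one_mul, one_mul, mul_one, inv_mul_cancel₀ hs1]
    · obtain ⟨a₁, ha₁, b₁, hb₁, c, hc, h⟩ := cell_of_triple₁₃ hU hV ht₂ ht₂d H₃.one_mem h1d hs hs1 x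
      refine ⟨a₁, ha₁, b₁, hb₁, c, hc, ?_⟩
      rw [h, hα, hβ, one_mul, one_mul, mul_one, mul_assoc, inv_mul_cancel₀ hs1, mul_one]

/-- **Full-torus corollary, placement `{1,3}`, in the crux's vocabulary.**  If
`H₁ ⊇ U⁺ · {diag(1, δ) : δ ≠ 0}` and `U⁻ ≤ H₃`, a level-1 identity design forces every `s ∈ H₂`
with `s₁₁ ≠ 0` to satisfy `det s = s₁₁` (`p ≠ 2`). -/
theorem no_levelOne_design_fullTorus₁₃ (hp2 : p ≠ 2) {H₁ H₂ H₃ : Subgroup (GLm p 2)}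
    (hU : ∀ u : GLm p 2, (u : Mat p 2) 1 0 = 0 → (u : Mat p 2) 0 0 = 1 → (u : Mat p 2) 1 1 = 1 →
      u ∈ H₁)
    (hV : ∀ v : GLm p 2, (v : Mat p 2) 0 1 = 0 → (v : Mat p 2) 0 0 = 1 → (v : Mat p 2) 1 1 = 1 →
      v ∈ H₃)
    (hT : ∀ δ : ZMod p, δ ≠ 0 → ∃ t ∈ H₁, (t : Mat p 2) = !![1, 0; 0, δ])
    {s : GLm p 2} (hs : s ∈ H₂) (hs1 : (s : Mat p 2) 1 1 ≠ 0)
    (hsd : Matrix.det (s : Mat p 2) ≠ (s : Mat p 2) 1 1) :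
    ¬ ∃ c : Mat p 2 → ℂ, (∀ M, 1 < M.rank → c M = 0) ∧
        (∑ M, c M * ZMod.stdAddChar (Matrix.trace (M * ((1 : GLm p 2) : Mat p 2)))) = 1 ∧
        ∀ a ∈ H₁, ∀ b ∈ H₂, ∀ g ∈ H₃, a * b * g ≠ 1 →
          (∑ M, c M *
            ZMod.stdAddChar (Matrix.trace (M * ((a * b * g : GLm p 2) : Mat p 2)))) = 0 := by
  rintro ⟨c, hc, hc1, hc0⟩
  -- `μ = -1 ∉ {0, 1}` for `p ≠ 2`
  have hμ0 : (-1 : ZMod p) ≠ 0 := neg_ne_zero.2 one_ne_zero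
  have hμ1 : (-1 : ZMod p) ≠ 1 := by
    have : ringChar (ZMod p) ≠ 2 := by rwa [ZMod.ringChar_zmod_n]
    exact Ring.neg_one_ne_one_of_char_ne_two this
  obtain ⟨tμ, htμ, htμd⟩ := hT (-1) hμ0
  obtain ⟨t₁, ht₁, ht₁d⟩ := hT _ (inv_ne_zero hs1)
  obtain ⟨t₂, ht₂, ht₂d⟩ := hT _ (mul_ne_zero hμ0 (inv_ne_zero hs1))
  refine no_idTest_triple_frame₁₃ hU hV hμ0 hμ1 hs hs1 hsd htμ htμd ht₁ ht₁d ht₂ ht₂d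
    ⟨fourierFn c, fourierFn_mem_levelSubmodule hc, hc1, fun a ha b hb g hg hne => ?_⟩
  exact hc0 a ha b hb g hg hne

end TripleShift

end Summit.MatrixMultiplication.MatrixMultiplication.Theorems.SubgroupIdentityDesigns.Negative

end
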